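import Literature.NumberTheory.LFunctions.Zhang2022.KnifeEdgeLenZDegreeClosed

/-!
# Zhang (2022), rung F-S3 (Landau–Siegel programme, §D edge len = E*-len⁺): card `z-degree-toeplitz-band`, BIRTH (4) —
# the PACKAGED crux of the ψ-graded line (critic's option β: the tables travel WITH the closing condition that evaluates
# their functionals), and its endgame (PROVED; nothing asserted)

Y. Zhang, *Discrete mean estimates and the Landau–Siegel zero*, arXiv:2211.02515v1 [Zhang2022LandauSiegel] —
an unrefereed manuscript under adjudication. **WHAT THIS IS NOT: not a claim about Theorems 1–2 of
arXiv:2211.02515, about Landau–Siegel zeros, or about Parity. The programme SEARCHES and TYPES; no claim about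
Landau–Siegel zeros, Theorems 1–2 of arXiv:2211.02515 or a repaired Margin232 until a kernel theorem says so.
`GradedClosesPsi c′` is a bare `Prop` (asserted by no one); the theorems are implications to the skeleton's `Theorem1/2`
with the Part-I claims discharged by the tree (`KnifeEdgeLenZDegreeClosed`).**

CONTEXT (cell landau-siegel §D; critic ls-knife-crit-1 g2, C0 pre-registration pin P-X and its clarification
2026-08-27T01:55:15Z, verbatim): «(β) ONE packaged closed Prop, e.g. `GradedClosesPsi c' := ∃ X₁ Y₁ X₂, CrossTablePsi c' 1 X₁ ∧
DualCrossTablePsi c' 1 Y₁ ∧ TauTwoTablePsi c' X₂ ∧ GradedCloses X₁ Y₁ X₂` — acceptable because the table statements PIN `X` on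
in-class pieces by uniqueness of asymptotics whenever (A)-characters are unbounded in `D` … and in the eventually-¬(A) world
the `∃` is vacuous-but-harmless … (γ) NOT acceptable: `GradedCloses X₁ Y₁ X₂` as its OWN route item with `X` free or own-`∃`.»
The uniqueness rungs are `crossTablePsi_unique` / `dualCrossTablePsi_unique` of `KnifeEdgeLenZDegreeBarrier`. This file types
(β) under the critic's name and proves its endgame: `theorem1_of_gradedClosesPsi_pack : (∀ c′ ≥ 0, InClassMean c′) →
(∀ c′ ≥ 0, GradedClosesPsi c′) → Theorem1` — the functionals may even depend on `c′`; the tree's threshold `c₀`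
(`lemma23_eventually`) is where they are used. Part 2 (the critic's T6, c′-uniformity): the same glue for route items stated in
the honest `∃ c₀, ∀ c′ ≥ c₀` shape — `theorem1_of_gradedClosesPsi_pack_eventually`, `theorem1_of_gradedClosesPsi_eventually`.

## References
* Y. Zhang, arXiv:2211.02515v1 (2022), §1 Theorems 1–2; §2 (2.16), §7 Prop 7.1, §8 (8.5). [cite: Zhang2022LandauSiegel, §1, §2 (2.16), §8 (8.5)]
-/

noncomputable section

open Complex Real ComplexConjugate

namespace Literature.NumberTheory.LFunctions.Zhang2022.KnifeEdge

open Repair Skeleton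

/-- **THE PACKAGED CRUX OF THE ψ-GRADED LINE (critic's option β, verbatim shape; OPEN — asserted by no one):** at the
constant `c′`, there are pair functionals `X₁, Y₁, X₂` such that the ψ-graded degree-1 cross table, the degree-1 dual
table and the degree-2 table (K1″) hold with them AND the graded main-term matrix they define fails PSD on some in-class
design. The tables pin the functionals on in-class pieces (`crossTablePsi_unique`, `dualCrossTablePsi_unique`), so the
`∃` is not the vacuous own-`∃` over the closing condition alone. [cite: Zhang2022LandauSiegel, §2 (2.16), §8 (8.5)] -/
def GradedClosesPsi (c' : ℝ) : Prop :=
  ∃ X₁ Y₁ X₂ : PairFunctional,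
    CrossTablePsi c' 1 X₁ ∧ DualCrossTablePsi c' 1 Y₁ ∧ TauTwoTablePsi c' X₂ ∧ GradedCloses X₁ Y₁ X₂

/-- Unpackaged data at one `c′` give the package. [cite: Zhang2022LandauSiegel, §2 (2.16)] -/
theorem gradedClosesPsi_of {c' : ℝ} {X₁ Y₁ X₂ : PairFunctional} (h1 : CrossTablePsi c' 1 X₁)
    (h21 : DualCrossTablePsi c' 1 Y₁) (h2 : TauTwoTablePsi c' X₂) (hC : GradedCloses X₁ Y₁ X₂) : GradedClosesPsi c' :=
  ⟨X₁, Y₁, X₂, h1, h21, h2, hC⟩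

/-- **ENDGAME OF THE PACKAGED LINE (proved):** Zhang's side tables for in-class pieces (`InClassMean`, (8.23) dictionary)
and the packaged crux, both for every `c′ ≥ 0`, give Theorem 1 — Prop. 2.2 (i) / Lemma 2.3 from the tree at its threshold
`c₀`. The functionals may depend on `c′`. [cite: Zhang2022LandauSiegel, §1 Theorem 1, §2 p. 6] -/
theorem theorem1_of_gradedClosesPsi_pack (h0 : ∀ c' : ℝ, 0 ≤ c' → InClassMean c')
    (h : ∀ c' : ℝ, 0 ≤ c' → GradedClosesPsi c') : Theorem1 := by
  obtain ⟨c₀, hc0, hcl⟩ := theorem1_of_gradedClosesPsi_closed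
  obtain ⟨X₁, Y₁, X₂, h1, h21, h2, hC⟩ := h c₀ hc0
  exact hcl c₀ le_rfl X₁ Y₁ X₂ (h0 c₀ hc0) h1 h21 h2 hC

/-- … and Theorem 2. [cite: Zhang2022LandauSiegel, §1 Theorem 2] -/
theorem theorem2_of_gradedClosesPsi_pack (h0 : ∀ c' : ℝ, 0 ≤ c' → InClassMean c')
    (h : ∀ c' : ℝ, 0 ≤ c' → GradedClosesPsi c') : Theorem2 :=
  Skeleton.theorem2_of_theorem1 (theorem1_of_gradedClosesPsi_pack h0 h)

/-- **N12 shape:** for every sufficiently large `c′`, side tables ∧ packaged crux ⇒ Theorem 1. [cite: Zhang2022LandauSiegel, §1 Theorem 1] -/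
theorem theorem1_of_gradedClosesPsi_pack_closed :
    ∃ c₀ : ℝ, 0 ≤ c₀ ∧ ∀ c' : ℝ, c₀ ≤ c' → InClassMean c' → GradedClosesPsi c' → Theorem1 := by
  obtain ⟨c₀, hc0, hcl⟩ := theorem1_of_gradedClosesPsi_closed
  refine ⟨c₀, hc0, fun c' hc' h0 h => ?_⟩
  obtain ⟨X₁, Y₁, X₂, h1, h21, h2, hC⟩ := h
  exact hcl c' hc' X₁ Y₁ X₂ h0 h1 h21 h2 hC

/-- **The `X₂ = 0` horn packages too:** degree-1 tables ∧ `TauTwoTablePsi c′ 0` (τ₂ dark) ∧ one in-class triple violating the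
tridiagonal Schur bound ⇒ `GradedClosesPsi c′` (`gradedCloses_dark_of_schur`). [cite: Zhang2022LandauSiegel, §2 (2.16)] -/
theorem gradedClosesPsi_of_schur_dark {c' : ℝ} {X₁ Y₁ : PairFunctional} (h1 : CrossTablePsi c' 1 X₁)
    (h21 : DualCrossTablePsi c' 1 Y₁) (h2 : TauTwoTablePsi c' 0) {f f' g₁ g₁' g₂ g₂' : ℝ → ℂ}
    (hf : InClassPiece f f') (hg₁ : InClassPiece g₁ g₁') (hg₂ : InClassPiece g₂ g₂')
    (hB0 : 0 < mainTermForm f f') (hB2 : 0 < mainTermForm g₂ g₂')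
    (hlt : mainTermForm g₁ g₁' < ‖X₁ f f' g₁ g₁'‖ ^ 2 / mainTermForm f f' + ‖Y₁ g₁ g₁' g₂ g₂'‖ ^ 2 / mainTermForm g₂ g₂') :
    GradedClosesPsi c' :=
  gradedClosesPsi_of h1 h21 h2 (gradedCloses_dark_of_schur hf hg₁ hg₂ hB0 hB2 hlt)

/-! ### Part 2 — c′-UNIFORMITY (C0 check T6): route items in the `∃ c₀, ∀ c′ ≥ c₀` shape, and their glue -/

section Eventually

variable {X₁ Y₁ X₂ : PairFunctional}

/-- **Glue for route items stated EVENTUALLY IN `c′`** (the critic's T6: «prefer the `∃ c₀, ∀ c' ≥ c₀` shape so the items are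
not misstated-strong»): side tables for all large `c′` ∧ the packaged crux for all large `c′` ⇒ Theorem 1 (take the max of
the three thresholds, the tree's included). [cite: Zhang2022LandauSiegel, §1 Theorem 1, §2 p. 6] -/
theorem theorem1_of_gradedClosesPsi_pack_eventually (h0 : ∃ c₁ : ℝ, ∀ c' : ℝ, c₁ ≤ c' → InClassMean c')
    (h : ∃ c₂ : ℝ, ∀ c' : ℝ, c₂ ≤ c' → GradedClosesPsi c') : Theorem1 := by
  obtain ⟨c₀, -, hcl⟩ := theorem1_of_gradedClosesPsi_pack_closed
  obtain ⟨c₁, h₁⟩ := h0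
  obtain ⟨c₂, h₂⟩ := h
  exact hcl (max c₀ (max c₁ c₂)) (le_max_left _ _)
    (h₁ _ (le_trans (le_max_left _ _) (le_max_right _ _)))
    (h₂ _ (le_trans (le_max_right _ _) (le_max_right _ _)))

/-- … and Theorem 2. [cite: Zhang2022LandauSiegel, §1 Theorem 2] -/
theorem theorem2_of_gradedClosesPsi_pack_eventually (h0 : ∃ c₁ : ℝ, ∀ c' : ℝ, c₁ ≤ c' → InClassMean c')
    (h : ∃ c₂ : ℝ, ∀ c' : ℝ, c₂ ≤ c' → GradedClosesPsi c') : Theorem2 :=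
  Skeleton.theorem2_of_theorem1 (theorem1_of_gradedClosesPsi_pack_eventually h0 h)

/-- **Unpackaged eventually-in-`c′` glue (option α with closed-form `X`'s):** each slot for all large `c′` (own threshold)
∧ `GradedCloses X₁ Y₁ X₂` ⇒ Theorem 1. [cite: Zhang2022LandauSiegel, §1 Theorem 1, §2 p. 6] -/
theorem theorem1_of_gradedClosesPsi_eventually (h0 : ∃ c₁ : ℝ, ∀ c' : ℝ, c₁ ≤ c' → InClassMean c')
    (h1 : ∃ c₂ : ℝ, ∀ c' : ℝ, c₂ ≤ c' → CrossTablePsi c' 1 X₁)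
    (h21 : ∃ c₃ : ℝ, ∀ c' : ℝ, c₃ ≤ c' → DualCrossTablePsi c' 1 Y₁)
    (h2 : ∃ c₄ : ℝ, ∀ c' : ℝ, c₄ ≤ c' → TauTwoTablePsi c' X₂) (hC : GradedCloses X₁ Y₁ X₂) : Theorem1 := by
  obtain ⟨c₁, h₁⟩ := h0
  obtain ⟨c₂, h₂⟩ := h1
  obtain ⟨c₃, h₃⟩ := h21
  obtain ⟨c₄, h₄⟩ := h2
  refine theorem1_of_gradedClosesPsi_pack_eventually ⟨c₁, h₁⟩ ⟨max c₂ (max c₃ c₄), fun c' hc' => ?_⟩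
  exact gradedClosesPsi_of (h₂ c' (le_trans (le_max_left _ _) hc'))
    (h₃ c' (le_trans (le_trans (le_max_left _ _) (le_max_right _ _)) hc'))
    (h₄ c' (le_trans (le_trans (le_max_right _ _) (le_max_right _ _)) hc')) hC

/-- … and Theorem 2. [cite: Zhang2022LandauSiegel, §1 Theorem 2] -/
theorem theorem2_of_gradedClosesPsi_eventually (h0 : ∃ c₁ : ℝ, ∀ c' : ℝ, c₁ ≤ c' → InClassMean c')
    (h1 : ∃ c₂ : ℝ, ∀ c' : ℝ, c₂ ≤ c' → CrossTablePsi c' 1 X₁)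
    (h21 : ∃ c₃ : ℝ, ∀ c' : ℝ, c₃ ≤ c' → DualCrossTablePsi c' 1 Y₁)
    (h2 : ∃ c₄ : ℝ, ∀ c' : ℝ, c₄ ≤ c' → TauTwoTablePsi c' X₂) (hC : GradedCloses X₁ Y₁ X₂) : Theorem2 :=
  Skeleton.theorem2_of_theorem1 (theorem1_of_gradedClosesPsi_eventually h0 h1 h21 h2 hC)

end Eventually

/-! ### Part 3 — the VACUOUS HORN of the packaged crux (C0 pre-check (3), critic ls-knife-crit-1 g2 2026-08-27T02:18:09Z,
kernel-verified scratch `ZDegVacuous.lean` b5bc3f88785e47a6, re-typed here in the tree's spelling of «¬(A) eventually»):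
`(ForAllLarge ¬(A)) → GradedClosesPsi c′` — the slots are (A)-guarded hence vacuous (desk ZD0 pattern) and the closing
condition with a FREE degree-2 table is trivially satisfiable (desk ZD2 pattern). HARMLESS for the route — the same hypothesis
gives `Theorem1` outright (`Skeleton.theorem1_of_eventually_not_assumptionA` = `KnifeEdgeEll.Vernier.theorem1_of_notAEventually`)
— but the BC5/T1 honesty line of the birth packet must SAY it: the crux's content lives on the (A)-infinitely-often horn, where
`crossTablePsi_unique` / `dualCrossTablePsi_unique` (`KnifeEdgeLenZDegreeBarrier`) pin the functionals and `GradedCloses` is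
real analysis. -/

section Vacuous

variable {c' : ℝ}

/-- An (A)-guarded cross-table slot is vacuous when (A) fails eventually. [cite: Zhang2022LandauSiegel, §2 p. 4, §8 (8.5)] -/
theorem crossTablePsi_of_notAEventually (h : ForAllLarge fun D _ χ => ¬ AssumptionA D χ) (d : ℕ) (X : PairFunctional) :
    CrossTablePsi c' d X :=
  fun _ _ _ _ _ _ _ _ => h.mono fun _ _ _ _ _ hn hA => absurd hA hn

/-- An (A)-guarded dual cross-table slot is vacuous when (A) fails eventually. [cite: Zhang2022LandauSiegel, §2 p. 4, §8 (8.5)] -/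
theorem dualCrossTablePsi_of_notAEventually (h : ForAllLarge fun D _ χ => ¬ AssumptionA D χ) (d : ℕ) (Y : PairFunctional) :
    DualCrossTablePsi c' d Y :=
  fun _ _ _ _ _ _ _ _ => h.mono fun _ _ _ _ _ hn hA => absurd hA hn

/-- The degree-2 slot (K1″ shape) is vacuous when (A) fails eventually. [cite: Zhang2022LandauSiegel, §2 p. 4, §8 (8.5)] -/
theorem tauTwoTablePsi_of_notAEventually (h : ForAllLarge fun D _ χ => ¬ AssumptionA D χ) (X₂ : PairFunctional) :
    TauTwoTablePsi c' X₂ :=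
  crossTablePsi_of_notAEventually h 2 X₂

/-- **Own-`∃` closing witness (desk ZD2 pattern):** for ANY degree-1 tables `X₁, Y₁` there is a degree-2 table — a huge
negative constant — whose graded main matrix fails PSD on the in-class triple `(g⋆, g⋆, g⋆)` with amplitudes `(1, 0, 1)`.
So `GradedCloses X₁ Y₁ X₂` with `X₂` FREE has no content; only the NAMED tables give it content (and `crossTablePsi_unique`
is why the packaged `∃` of `GradedClosesPsi` is not this one on the (A)-infinitely-often horn). [cite: Zhang2022LandauSiegel, §2 (2.16), §7 Prop 7.1 (7.2)] -/
theorem exists_tauTwoTable_gradedCloses (X₁ Y₁ : PairFunctional) : ∃ X₂ : PairFunctional, GradedCloses X₁ Y₁ X₂ := by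
  refine ⟨fun _ _ _ _ => -((mainTermForm gStar gStar' : ℂ) + 1), gStar, gStar', gStar, gStar', gStar, gStar',
    ![1, 0, 1], inClassPiece_gStar, inClassPiece_gStar, inClassPiece_gStar, ?_⟩
  simp [gradedQuadForm, gradedMainMatrix, Fin.sum_univ_three, Complex.conj_ofReal]

/-- **THE VACUOUS HORN (proved; the critic's C0 pre-check (3) verbatim in content):** if (A) fails for every real primitive
character to every large modulus, the packaged crux `GradedClosesPsi c′` holds for every `c′` — all three slots vacuously
with the zero tables, the closing condition by `exists_tauTwoTable_gradedCloses`. [cite: Zhang2022LandauSiegel, §2 p. 4, (2.16)] -/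
theorem gradedClosesPsi_of_notAEventually (h : ForAllLarge fun D _ χ => ¬ AssumptionA D χ) (c' : ℝ) :
    GradedClosesPsi c' := by
  obtain ⟨X₂, hC⟩ := exists_tauTwoTable_gradedCloses 0 0
  exact ⟨0, 0, X₂, crossTablePsi_of_notAEventually h 1 0, dualCrossTablePsi_of_notAEventually h 1 0,
    tauTwoTablePsi_of_notAEventually h X₂, hC⟩

end Vacuous

/-! ### Part 4 — the packaged crux IS «(A) fails eventually» once the in-class means hold (C0 finding of the critic
ls-knife-crit-1 g2, 2026-08-27T02:52:02Z, kernel-verified scratch `ZDegEquiv.lean` 1089cdc8e8074591, re-typed in the tree's spelling):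
`InClassMean c′ → Prop22i → Lemma23 c′ → (GradedClosesPsi c′ ↔ ForAllLarge ¬(A))`, and its closed form for all large `c′`
with Part I discharged by the tree. READING (the critic's): «(A) fails eventually» is Theorem 1's shape with constant 1,
so as a ledger work item the option-β package has NO attack surface of its own — proving it IS proving no-(A)-eventually,
refuting it IS exhibiting (A) infinitely often; its only independent content is the FORMULA-LEVEL path (closed-form
`X₁^ψ, Y₁^ψ, X₂^ψ`, their slot theorems, and `GradedCloses`/`GradedPSD` OF THOSE DEFS). The package stays the glue-facing
assembly (`gradedClosesPsi_of`). -/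

section Equivalence

variable {c' : ℝ}

/-- **The glue read as it is (proved):** in-class means ∧ Prop. 2.2 (i) ∧ Lemma 2.3 at `c′` ∧ the packaged crux ⇒ (A)
fails for every real primitive character to every large modulus (the Gram endgame `eventually_not_assumptionA_of_gramSlots`
on the ψ-graded slots `gramEntryAsymp_psi`). Stronger than `Theorem1`'s shape. [cite: Zhang2022LandauSiegel, §2 p. 6, (2.16)] -/
theorem notAEventually_of_gradedClosesPsi (h0 : InClassMean c') (h22 : Prop22i) (h23 : Lemma23 c')
    (hG : GradedClosesPsi c') : ForAllLarge fun D _ χ => ¬ AssumptionA D χ := by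
  obtain ⟨X₁, Y₁, X₂, h1, h21, h2, hC⟩ := hG
  obtain ⟨f, f', g₁, g₁', g₂, g₂', s, hf, hg₁, hg₂, hneg⟩ := hC
  exact eventually_not_assumptionA_of_gramSlots (gramEntryAsymp_psi h0 h1 h21 h2 h22 hf hg₁ hg₂) hneg h22 h23

/-- **THE EQUIVALENCE (proved):** given the in-class means, Prop. 2.2 (i) and Lemma 2.3 at `c′`, the option-β crux
`GradedClosesPsi c′` is EXACTLY «(A) fails for every large modulus» (`notAEventually_of_gradedClosesPsi` and the vacuous
horn `gradedClosesPsi_of_notAEventually`). [cite: Zhang2022LandauSiegel, §2 p. 4, p. 6, (2.16)] -/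
theorem gradedClosesPsi_iff_notAEventually (h0 : InClassMean c') (h22 : Prop22i) (h23 : Lemma23 c') :
    GradedClosesPsi c' ↔ ForAllLarge fun D _ χ => ¬ AssumptionA D χ :=
  ⟨notAEventually_of_gradedClosesPsi h0 h22 h23, fun h => gradedClosesPsi_of_notAEventually h c'⟩

/-- **Closed form (proved):** there is `c₀ ≥ 0` such that for every `c′ ≥ c₀`,
`InClassMean c′ → (GradedClosesPsi c′ ↔ ForAllLarge ¬(A))` — Part I (`prop22i_holds`, `lemma23_eventually`) discharged
by the tree. So the route's deciding items must be formula-level; the package is the assembly.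
[cite: Zhang2022LandauSiegel, §2 p. 4, p. 6, (2.16)] -/
theorem gradedClosesPsi_iff_notAEventually_closed :
    ∃ c₀ : ℝ, 0 ≤ c₀ ∧ ∀ c' : ℝ, c₀ ≤ c' → InClassMean c' →
      (GradedClosesPsi c' ↔ ForAllLarge fun D _ χ => ¬ AssumptionA D χ) := by
  obtain ⟨c₀, h0, h⟩ := lemma23_eventually
  exact ⟨c₀, h0, fun c' hc' hI => gradedClosesPsi_iff_notAEventually hI prop22i_holds (h c' hc')⟩

end Equivalence

end Literature.NumberTheory.LFunctions.Zhang2022.KnifeEdge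

end
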